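import Summits.QuantumFields.YangMills.Theorems.BalabanLadderIRTwistedSlabOrbitLaplace
import Summits.QuantumFields.YangMills.Theorems.BalabanLadderIRTwistedSlabClassicalRate
import Summits.QuantumFields.YangMills.Theorems.BalabanLadderIRTwistedSlabDefs
import HarnessLib

/-!
# T1-TREE-EXACT (existence form): the `β → ∞` LIMIT of the e₂-projected twisted slab purity defect at ONE box EXISTS and equals
# `1 − C(2t) ∕ (q · C(t)²)` — `C(·)` the tree-level constants of `…TwistedSlabOrbitLaplace` (K23), `q = #{k′ < n : z^{k′} = 1} ∕ n`

HELPER toward stub **T1** `TwistedSlabAnchor` (LINE `twisted-slab-continuity`, crux `IRcof` stmt-QuantumFields-26930, census row 43;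
LEAD prover ym-ir-line-tsc-p1 g4; `--supports` the crux, `--as helper`).  Sequel of K23 (`…OrbitLaplace`), g0's `…ClassicalRate`
(`tendsto_twistRatio_zero_specialUnitary`: the `z^{k′} ≠ 1` summands are `o(W{z,1})`) and the line's vocabulary `…Defs` (`projSlabZ`, `projSlabDefect`).
Proof file: theorems only.  Norm scope `Matrix.Norms.L2Operator` (B89's `specialUnitaryLogChart`; only `finrank`s cross).
* §1 DIMENSION BOOKKEEPING: `card_finTorusSite`, `finrank_pi_suFields` ∕ ★ `finrank_suFields` (`dim_ℝ suFields = n₀n₁n₂n₃ · dim 𝔰𝔲(N)`, through K16a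
  `adFrame` and B89 `lieEquivPi`), ★ `finrank_realCoulombSlice_ladder` (`dim_ℝ` of the real Coulomb slice at a twist-eating ladder `= 3 · |sites| · dim 𝔰𝔲(N)`,
  K14 `realGaugeSliceEquiv`); hence the Laplace exponent `m(box)∕2` DOUBLES with the time extent.
* §2 ★★ `tendsto_rpow_mul_twistedPartition_slab_euclidean` — K23's limit with the exponent written as the NUMBER `3·|sites|·dim 𝔰𝔲(N) ∕ 2`, frames by
  `EuclideanSpace` models (`ContinuousLinearEquiv.ofFinrankEq`), reference pair from lit-4 `exists_pair_commutator_eq_suCenter`: for `N ≥ 2`, `k` a unit and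
  every box `(m+1)² × (m₂+1) × (m₃+1)`: `∃ C > 0, β^{3|sites|d∕2} · W{ω^k·1, 1}(β) ⟶ C`.
* §3 ★ `tendsto_projSlabZ_div_twistedPartition` — `projSlabZ(β) ∕ W{z,1}(β) ⟶ q = n⁻¹ · #{k′ < n : z^{k′} = 1} > 0` (`z = ω^k·1`; g0's ratio lemma for
  the summands with `z^{k′} ≠ 1`).
* §4 ★★★ `tendsto_projSlabDefect_classical` — **T1-TREE-EXACT, existence form**: for `N ≥ 2`, `k` a unit, `0 < n`, every box:
  `projSlabDefect (fundamentalRep) β (ω^k·1) n (m+1) (m₂+1) (m₃+1) ⟶ 1 − C₂ ∕ (q · C₁²)` as `β → ∞`, where `β^{a}·W₁(β; t-box) → C₁ > 0`,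
  `β^{2a}·W₁(β; 2t-box) → C₂ > 0` (the exponent of the doubled box is EXACTLY twice that of the box, §1).
NOT here (honest scope): the closed form of `C₂ ∕ (q C₁²)` (= g2's `harmonicDefect` product, THE NUMBER: lit-4 L24 + Haar chart of `𝒢` + K8 + B89 window
constants); anything UNIFORM in `β` (T1-box = M3) or in `L, t` (T1 = M4); T1-box 0∕1, T1 proper 0∕1.

HONEST FRAMING: the classical (`β → ∞`) limit at ONE fixed box; nothing here bears on `IRcof`, `IR`, or the Yang–Mills mass gap (Clay: NOT proved); R4 =
`BalabanLadder.UV` only.  References: G. 't Hooft, Nucl. Phys. B153 (1979) §5; A. González-Arroyo (1998) §4.2; E. Hasenpflug, D. Rudolf, B. Sprungk (2024) App. 4.1.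
-/

set_option autoImplicit false

noncomputable section

open scoped Matrix Matrix.Norms.L2Operator Topology ENNReal
open MeasureTheory Filter Set Metric Module
open Literature.MathematicalPhysics.QuantumFieldTheory Literature.MathematicalPhysics.QuantumLattice
open Literature.MathematicalPhysics.QuantumFieldTheory.Balaban1983to89
open Literature.MathematicalPhysics.QuantumFieldTheory.Balaban1983to89.LogChartProduct
open Literature.Analysis.Asymptotics

namespace Summit.QuantumFields.YangMills.Cruxes.IRcof.TwistedSlab

variable {N : ℕ}

/-! ## §1 Dimension bookkeeping -/

section Dimension

variable [NeZero N] {n₀ n₁ n₂ n₃ : ℕ}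

/-- `|sites| = n₀ n₁ n₂ n₃`. [folklore] -/
theorem card_finTorusSite : Fintype.card (FinTorusSite n₀ n₁ n₂ n₃) = n₀ * n₁ * n₂ * n₃ := by
  simp only [FinTorusSite, Fintype.card_prod, Fintype.card_fin]; ring

/-- `dim_ℝ (Fin 4 → suFields) = 4|sites| · dim 𝔰𝔲(N)` (K16a `adFrame` at the trivial background + B89 `lieEquivPi`). [folklore] -/
theorem finrank_pi_suFields : finrank ℝ (Fin 4 → suFields N n₀ n₁ n₂ n₃) = n₀ * n₁ * n₂ * n₃ * 4 * finrank ℝ (specialUnitaryLogChart (Fin N)).lie := by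
  have h1 := (adFrame (N := N) (n₀ := n₀) (n₁ := n₁) (n₂ := n₂) (n₃ := n₃) (L := fun _ => 1) fun _ => Submonoid.one_mem _).toLinearEquiv.finrank_eq
  rw [h1, (lieEquivPi (specialUnitaryLogChart (Fin N)) (FinTorusSite n₀ n₁ n₂ n₃ × Fin 4)).finrank_eq, Module.finrank_pi_fintype,
    Finset.sum_const, Finset.card_univ, smul_eq_mul, Fintype.card_prod, card_finTorusSite, Fintype.card_fin]

/-- ★ `dim_ℝ suFields = |sites| · dim 𝔰𝔲(N)`. [folklore] -/
theorem finrank_suFields : finrank ℝ (suFields N n₀ n₁ n₂ n₃) = n₀ * n₁ * n₂ * n₃ * finrank ℝ (specialUnitaryLogChart (Fin N)).lie := by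
  have h := finrank_pi_suFields (N := N) (n₀ := n₀) (n₁ := n₁) (n₂ := n₂) (n₃ := n₃)
  rw [Module.finrank_pi_fintype, Finset.sum_const, Finset.card_univ, Fintype.card_fin, smul_eq_mul] at h
  linarith

variable {m n₂' n₃' : ℕ} {A B : Matrix (Fin N) (Fin N) ℂ} {ω : ℂ} {Γ₂ Γ₃ : Matrix (Fin N) (Fin N) ℂ}

/-- ★ **Three transverse polarisations per site and colour**: `dim_ℝ realCoulombSlice L = 3 · |sites| · dim 𝔰𝔲(N)` at a twist-eating ladder
(K14's real Hodge decomposition `suFields × realCoulombSlice L ≃ (Fin 4 → suFields)`). [cite: GarciaperezGonzalezarroyoOkawa2017, §2.5] -/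
theorem finrank_realCoulombSlice_ladder (hAu : A ∈ Matrix.unitaryGroup (Fin N) ℂ) (hBu : B ∈ Matrix.unitaryGroup (Fin N) ℂ) (hω : IsPrimitiveRoot ω N)
    (hAB : A * B = ω • (B * A)) (hNm : 2 ≤ N * (m + 1))
    (hL : ∀ e, ladderField (n₀ := m + 1) (n₁ := m + 1) (n₂ := n₂') (n₃ := n₃') ![A, B, Γ₂, Γ₃] e ∈ Matrix.unitaryGroup (Fin N) ℂ) :
    finrank ℝ (realCoulombSlice (ladderField (n₀ := m + 1) (n₁ := m + 1) (n₂ := n₂') (n₃ := n₃') ![A, B, Γ₂, Γ₃])) =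
      3 * ((m + 1) * (m + 1) * n₂' * n₃' * finrank ℝ (specialUnitaryLogChart (Fin N)).lie) := by
  have h := (realGaugeSliceEquiv hAu hBu hω hAB hNm hL).finrank_eq
  rw [Module.finrank_prod, finrank_pi_suFields, finrank_suFields] at h
  linarith

end Dimension

/-! ## §2 The tree-level limit of the twisted partition function, frames discharged -/

section Partition

variable [NeZero N] {m m₂ m₃ : ℕ}

/-- ★★ **T1-TREE (one box), frame-free**: for `N ≥ 2`, a unit `k` and every box `(m+1)² × (m₂+1) × (m₃+1)` there is `C > 0` with
`β^{3·|sites|·dim 𝔰𝔲(N) ∕ 2} · W{ω^k·1, 1}(β) ⟶ C` (K23 with Euclidean models of the gauge algebra and of the `N²` Coulomb slices, and lit-4's reference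
pair `exists_pair_commutator_eq_suCenter`). [cite: HasenpflugRudolfSprungk2024, App. 4.1 Thm 16] [cite: Gonzalezarroyo1998, §4.2] -/
theorem tendsto_rpow_mul_twistedPartition_slab_euclidean (hN : 2 ≤ N) {k : ZMod N} (hk : IsUnit k) :
    ∃ C : ℝ, 0 < C ∧ Tendsto (fun β : ℝ =>
      β ^ ((3 * ((m + 1) * (m + 1) * (m₂ + 1) * (m₃ + 1) * finrank ℝ (specialUnitaryLogChart (Fin N)).lie) : ℕ) / 2 : ℝ) *
        wilsonFinTorusTensorTwistedPartition (fundamentalRep (Fin N)) β (slabTwist (suCenter N k : Matrix.specialUnitaryGroup (Fin N) ℂ) 1)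
          (m + 1) (m + 1) (m₂ + 1) (m₃ + 1)) atTop (𝓝 C) := by
  -- a reference twist-eating pair with `B A B⁻¹ A⁻¹ = ω^k·1`
  obtain ⟨B, A, hAB⟩ := exists_pair_commutator_eq_suCenter (N := N) k
  have hNm : 2 ≤ N * (m + 1) := le_trans hN (Nat.le_mul_of_pos_right N (Nat.succ_pos m))
  have hAu : (A : Matrix (Fin N) (Fin N) ℂ) ∈ Matrix.unitaryGroup (Fin N) ℂ := Matrix.specialUnitaryGroup_le_unitaryGroup A.2
  have hBu : (B : Matrix (Fin N) (Fin N) ℂ) ∈ Matrix.unitaryGroup (Fin N) ℂ := Matrix.specialUnitaryGroup_le_unitaryGroup B.2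
  have hω := isPrimitiveRoot_star_centerPhase (N := N) hk
  have hAB' := coe_mul_eq_smul_of_commutator_eq hAB
  set d := (m + 1) * (m + 1) * (m₂ + 1) * (m₃ + 1) * finrank ℝ (specialUnitaryLogChart (Fin N)).lie with hd
  -- Euclidean models
  have hM : finrank ℝ (EuclideanSpace ℝ (Fin d)) = finrank ℝ (suFields N (m + 1) (m + 1) (m₂ + 1) (m₃ + 1)) := by
    rw [finrank_euclideanSpace_fin, finrank_suFields]
  have hV : ∀ p : ZMod N × ZMod N, finrank ℝ (EuclideanSpace ℝ (Fin (3 * d))) =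
      finrank ℝ (realCoulombSlice (ladderField (n₀ := m + 1) (n₁ := m + 1) (n₂ := m₂ + 1) (n₃ := m₃ + 1)
        ![(A : Matrix (Fin N) (Fin N) ℂ), (B : Matrix (Fin N) (Fin N) ℂ), centerPhase N p.1 • (1 : Matrix (Fin N) (Fin N) ℂ), centerPhase N p.2 • (1 : Matrix (Fin N) (Fin N) ℂ)])) := by
    intro p
    rw [finrank_euclideanSpace_fin, finrank_realCoulombSlice_ladder hAu hBu hω hAB' hNm
      (fun e => Matrix.specialUnitaryGroup_le_unitaryGroup (ladderFieldPair_mem_specialUnitaryGroup A B p.1 p.2 e))]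
  obtain ⟨C, hC, hlim⟩ := tendsto_rpow_mul_twistedPartition_slab (M := EuclideanSpace ℝ (Fin d)) (V := EuclideanSpace ℝ (Fin (3 * d))) hk hAB hNm
    (ContinuousLinearEquiv.ofFinrankEq hM) (fun p => ContinuousLinearEquiv.ofFinrankEq (hV p))
  refine ⟨C, hC, ?_⟩
  rw [finrank_euclideanSpace_fin] at hlim
  exact hlim

end Partition

/-! ## §3 The projection: `projSlabZ ∕ W{z,1} → q` -/

section Projection

variable [NeZero N] {m₀ m₁ m₂ m₃ : ℕ}

/-- ★ **The e₂-projection in the classical limit**: `projSlabZ(β) ∕ W{ω^k·1, 1}(β) ⟶ q := n⁻¹ · #{k′ < n : (ω^k·1)^{k′} = 1}` as `β → ∞`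
(the summands with `z^{k′} ≠ 1` carry an orthogonal electric twist and are exponentially smaller, g0 `tendsto_twistRatio_zero_specialUnitary`);
`q > 0` when `n > 0`. [cite: tHooft1979Flux, §5 (5.2)–(5.4)] -/
theorem tendsto_projSlabZ_div_twistedPartition {k : ZMod N} (hk : IsUnit k) {n : ℕ} (hn : 0 < n) :
    Tendsto (fun β : ℝ => projSlabZ (fundamentalRep (Fin N)) β (suCenter N k : Matrix.specialUnitaryGroup (Fin N) ℂ) n (m₀ + 1) (m₂ + 1) (m₃ + 1) /
        wilsonFinTorusTensorTwistedPartition (fundamentalRep (Fin N)) β (slabTwist (suCenter N k : Matrix.specialUnitaryGroup (Fin N) ℂ) 1)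
          (m₀ + 1) (m₀ + 1) (m₂ + 1) (m₃ + 1)) atTop
      (𝓝 ((n : ℝ)⁻¹ * ((Finset.univ.filter fun j : Fin n =>
        (suCenter N k : Matrix.specialUnitaryGroup (Fin N) ℂ) ^ (j : ℕ) = 1).card : ℝ))) ∧
    0 < (n : ℝ)⁻¹ * ((Finset.univ.filter fun j : Fin n => (suCenter N k : Matrix.specialUnitaryGroup (Fin N) ℂ) ^ (j : ℕ) = 1).card : ℝ) := by
  classical
  set z := (suCenter N k : Matrix.specialUnitaryGroup (Fin N) ℂ) with hz
  set W₁ : ℝ → ℝ := fun β => wilsonFinTorusTensorTwistedPartition (fundamentalRep (Fin N)) β (slabTwist z 1) (m₀ + 1) (m₀ + 1) (m₂ + 1) (m₃ + 1) with hW₁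
  have hW₁pos : ∀ β, 0 < W₁ β := fun β => wilsonFinTorusTensorTwistedPartition_pos _ (continuous_fundamentalRep (Fin N)) β _ _ _ _ _
  -- each summand ratio converges: to `1` if `z^j = 1`, to `0` otherwise
  have hterm : ∀ j : Fin n, Tendsto (fun β : ℝ => wilsonFinTorusTensorTwistedPartition (fundamentalRep (Fin N)) β (slabTwist z (z ^ (j : ℕ)))
      (m₀ + 1) (m₀ + 1) (m₂ + 1) (m₃ + 1) / W₁ β) atTop (𝓝 (if z ^ (j : ℕ) = 1 then 1 else 0)) := by
    intro j
    by_cases hj : z ^ (j : ℕ) = 1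
    · rw [if_pos hj, hj]
      exact tendsto_const_nhds.congr' (Eventually.of_forall fun β => (div_self (hW₁pos β).ne').symm)
    · rw [if_neg hj]
      exact tendsto_twistRatio_zero_specialUnitary hk (Subgroup.pow_mem _ (suCenter N k).2 _) hj (continuous_fundamentalRep (Fin N))
        (fundamentalRep_mem_unitaryGroup (n := Fin N)) (fundamentalRep_injective (Fin N))
  have hsum := tendsto_finsetSum Finset.univ fun j _ => hterm j
  have hq : (∑ j : Fin n, (if z ^ (j : ℕ) = 1 then (1 : ℝ) else 0)) =
      ((Finset.univ.filter fun j : Fin n => z ^ (j : ℕ) = 1).card : ℝ) := by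
    rw [Finset.sum_ite, Finset.sum_const_zero, add_zero, Finset.sum_const, nsmul_eq_mul, mul_one]
  refine ⟨?_, ?_⟩
  · have h := hsum.const_mul (n : ℝ)⁻¹
    rw [hq] at h
    refine h.congr' (Eventually.of_forall fun β => ?_)
    simp only [projSlabZ, hW₁]
    rw [mul_div_assoc, Finset.sum_div]
  · have hcard : 0 < (Finset.univ.filter fun j : Fin n => z ^ (j : ℕ) = 1).card :=
      Finset.card_pos.2 ⟨⟨0, hn⟩, Finset.mem_filter.2 ⟨Finset.mem_univ _, by simp⟩⟩
    have hn' : (0 : ℝ) < n := by exact_mod_cast hn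
    positivity

end Projection

/-! ## §4 T1-TREE-EXACT (existence form): the classical limit of the projected defect -/

section Defect

variable [NeZero N] {m m₂ m₃ : ℕ}

/-- ★★★ **T1-TREE-EXACT, EXISTENCE FORM.**  `SU(N)` with `N ≥ 2`, `k` a unit of `ℤ/N` (magnetic twist `z = ω^k·1`), `0 < n`, any box
`(m+1)² × (m₂+1) × (m₃+1)`.  With `a = 3·|sites(t-box)|·dim 𝔰𝔲(N) ∕ 2`, the tree-level constants `β^{a} W{z,1}(β; t-box) → C₁ > 0`,
`β^{2a} W{z,1}(β; 2t-box) → C₂ > 0` (§2: the doubled box has exactly twice the exponent) and the projection weight `q > 0` (§3):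
`projSlabDefect (fundamentalRep) β z n (m+1) (m₂+1) (m₃+1) ⟶ 1 − C₂ ∕ (q · C₁²)` as `β → ∞`.
The closed form of the limit (g2's `harmonicDefect` product) is THE NUMBER, not claimed here. [cite: tHooft1979Flux, §5]
[cite: HasenpflugRudolfSprungk2024, App. 4.1 Thm 16 ∕ Remark 17] [cite: Gonzalezarroyo1998, §4.2] -/
theorem tendsto_projSlabDefect_classical (hN : 2 ≤ N) {k : ZMod N} (hk : IsUnit k) {n : ℕ} (hn : 0 < n) :
    ∃ C₁ C₂ q : ℝ, 0 < C₁ ∧ 0 < C₂ ∧ 0 < q ∧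
      Tendsto (fun β : ℝ =>
        β ^ ((3 * ((m + 1) * (m + 1) * (m₂ + 1) * (m₃ + 1) * finrank ℝ (specialUnitaryLogChart (Fin N)).lie) : ℕ) / 2 : ℝ) *
          wilsonFinTorusTensorTwistedPartition (fundamentalRep (Fin N)) β (slabTwist (suCenter N k : Matrix.specialUnitaryGroup (Fin N) ℂ) 1)
            (m + 1) (m + 1) (m₂ + 1) (m₃ + 1)) atTop (𝓝 C₁) ∧
      Tendsto (fun β : ℝ =>
        β ^ ((3 * ((m + 1) * (m + 1) * (m₂ + 1) * (2 * m₃ + 1 + 1) * finrank ℝ (specialUnitaryLogChart (Fin N)).lie) : ℕ) / 2 : ℝ) *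
          wilsonFinTorusTensorTwistedPartition (fundamentalRep (Fin N)) β (slabTwist (suCenter N k : Matrix.specialUnitaryGroup (Fin N) ℂ) 1)
            (m + 1) (m + 1) (m₂ + 1) (2 * m₃ + 1 + 1)) atTop (𝓝 C₂) ∧
      Tendsto (fun β : ℝ => projSlabZ (fundamentalRep (Fin N)) β (suCenter N k : Matrix.specialUnitaryGroup (Fin N) ℂ) n (m + 1) (m₂ + 1) (m₃ + 1) /
        wilsonFinTorusTensorTwistedPartition (fundamentalRep (Fin N)) β (slabTwist (suCenter N k : Matrix.specialUnitaryGroup (Fin N) ℂ) 1)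
          (m + 1) (m + 1) (m₂ + 1) (m₃ + 1)) atTop (𝓝 q) ∧
      Tendsto (fun β : ℝ => projSlabDefect (fundamentalRep (Fin N)) β (suCenter N k : Matrix.specialUnitaryGroup (Fin N) ℂ) n (m + 1) (m₂ + 1) (m₃ + 1))
        atTop (𝓝 (1 - C₂ / (q * C₁ ^ 2))) := by
  obtain ⟨C₁, hC₁, h₁⟩ := tendsto_rpow_mul_twistedPartition_slab_euclidean (m := m) (m₂ := m₂) (m₃ := m₃) hN hk
  obtain ⟨C₂, hC₂, h₂⟩ := tendsto_rpow_mul_twistedPartition_slab_euclidean (m := m) (m₂ := m₂) (m₃ := 2 * m₃ + 1) hN hk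
  obtain ⟨hq₁, hq₁pos⟩ := tendsto_projSlabZ_div_twistedPartition (m₀ := m) (m₂ := m₂) (m₃ := m₃) hk hn
  obtain ⟨hq₂, -⟩ := tendsto_projSlabZ_div_twistedPartition (m₀ := m) (m₂ := m₂) (m₃ := 2 * m₃ + 1) hk hn
  set q : ℝ := (n : ℝ)⁻¹ * ((Finset.univ.filter fun j : Fin n =>
    (suCenter N k : Matrix.specialUnitaryGroup (Fin N) ℂ) ^ (j : ℕ) = 1).card : ℝ) with hqdef
  refine ⟨C₁, C₂, q, hC₁, hC₂, hq₁pos, h₁, h₂, hq₁, ?_⟩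
  -- abbreviations
  set a : ℝ := ((3 * ((m + 1) * (m + 1) * (m₂ + 1) * (m₃ + 1) * finrank ℝ (specialUnitaryLogChart (Fin N)).lie) : ℕ) : ℝ) / 2 with ha
  set a₂ : ℝ := ((3 * ((m + 1) * (m + 1) * (m₂ + 1) * (2 * m₃ + 1 + 1) * finrank ℝ (specialUnitaryLogChart (Fin N)).lie) : ℕ) : ℝ) / 2 with ha₂
  have haa : a₂ = 2 * a := by
    simp only [ha, ha₂]
    push_cast
    ring
  set W₁ : ℝ → ℝ := fun β => wilsonFinTorusTensorTwistedPartition (fundamentalRep (Fin N)) β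
    (slabTwist (suCenter N k : Matrix.specialUnitaryGroup (Fin N) ℂ) 1) (m + 1) (m + 1) (m₂ + 1) (m₃ + 1) with hW₁
  set W₂ : ℝ → ℝ := fun β => wilsonFinTorusTensorTwistedPartition (fundamentalRep (Fin N)) β
    (slabTwist (suCenter N k : Matrix.specialUnitaryGroup (Fin N) ℂ) 1) (m + 1) (m + 1) (m₂ + 1) (2 * m₃ + 1 + 1) with hW₂
  set P₁ : ℝ → ℝ := fun β => projSlabZ (fundamentalRep (Fin N)) β (suCenter N k : Matrix.specialUnitaryGroup (Fin N) ℂ) n (m + 1) (m₂ + 1) (m₃ + 1) with hP₁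
  set P₂ : ℝ → ℝ := fun β => projSlabZ (fundamentalRep (Fin N)) β (suCenter N k : Matrix.specialUnitaryGroup (Fin N) ℂ) n (m + 1) (m₂ + 1) (2 * m₃ + 1 + 1)
    with hP₂
  have hW₁pos : ∀ β, 0 < W₁ β := fun β => wilsonFinTorusTensorTwistedPartition_pos _ (continuous_fundamentalRep (Fin N)) β _ _ _ _ _
  have hW₂pos : ∀ β, 0 < W₂ β := fun β => wilsonFinTorusTensorTwistedPartition_pos _ (continuous_fundamentalRep (Fin N)) β _ _ _ _ _
  -- the ratio `P₂ / P₁² = (β^{2a} W₂)(P₂/W₂) / ((β^a W₁)(P₁/W₁))²` for `β > 0`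
  have hkey : ∀ β : ℝ, 0 < β → P₂ β / P₁ β ^ 2 = (β ^ a₂ * W₂ β) * (P₂ β / W₂ β) / ((β ^ a * W₁ β) * (P₁ β / W₁ β)) ^ 2 := by
    intro β hβ
    have hβa : β ^ a₂ = (β ^ a) ^ 2 := by rw [haa, mul_comm, Real.rpow_mul hβ.le, Real.rpow_two]
    have h1 : (β ^ a) ≠ 0 := (Real.rpow_pos_of_pos hβ a).ne'
    have h2 : W₁ β ≠ 0 := (hW₁pos β).ne'
    have h3 : W₂ β ≠ 0 := (hW₂pos β).ne'
    rw [hβa]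
    field_simp
  have hlim : Tendsto (fun β : ℝ => (β ^ a₂ * W₂ β) * (P₂ β / W₂ β) / ((β ^ a * W₁ β) * (P₁ β / W₁ β)) ^ 2) atTop
      (𝓝 (C₂ * q / (C₁ * q) ^ 2)) :=
    (h₂.mul hq₂).div ((h₁.mul hq₁).pow 2) (by positivity)
  have hval : C₂ * q / (C₁ * q) ^ 2 = C₂ / (q * C₁ ^ 2) := by
    field_simp
  have hratio : Tendsto (fun β : ℝ => P₂ β / P₁ β ^ 2) atTop (𝓝 (C₂ / (q * C₁ ^ 2))) := by
    rw [← hval]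
    refine hlim.congr' ?_
    filter_upwards [eventually_gt_atTop (0 : ℝ)] with β hβ
    exact (hkey β hβ).symm
  have hdef : ∀ β : ℝ, projSlabDefect (fundamentalRep (Fin N)) β (suCenter N k : Matrix.specialUnitaryGroup (Fin N) ℂ) n (m + 1) (m₂ + 1) (m₃ + 1) =
      1 - P₂ β / P₁ β ^ 2 := fun β => rfl
  have h := (tendsto_const_nhds (x := (1 : ℝ))).sub hratio
  refine h.congr' (Eventually.of_forall fun β => ?_)
  exact (hdef β).symm

end Defect

end Summit.QuantumFields.YangMills.Cruxes.IRcof.TwistedSlab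

end
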